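import Mathlib
import Summits.SmoothPoincare4.SmoothPoincare4.Theorems.SullivanDualWitnessChargeHelperFlatZalcman
import Summits.SmoothPoincare4.SmoothPoincare4.Theorems.SullivanDualWitnessChargeHelperGradBoundOfC0Aux

/-!
# Helper `helper_gradBoundOfC0_of` of line `Sketch` for crux `WitnessCharge`
(item stmt-SmoothPoincare4-7824, route `SullivanDual`; discharge of the named fact
`JHolomorphicWeierstrassR4`, Zalcman upgrade: `C⁰_loc` convergence forces local gradient bounds)

**Statement.** Let `J` be a smooth almost complex structure on `ℝ⁴`, `U ⊆ ℂ` open and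
`u n : ℂ → ℝ⁴` maps that are `C^∞` and flat-`J`-holomorphic on `U` and converge locally uniformly
on `U`.  GIVEN (first hypothesis `hD`) derivative bounds of all orders on compact subsets for
flat-`J`-holomorphic sequences with `C⁰` and `C¹` bounds on compact subsets, and (second hypothesis
`hS`) the local smooth-limit lemma, the gradients `‖d(u n)‖` are bounded on every compact
`K ⊆ U`, uniformly in `n`.

**Proof (Zalcman–Brody rescaling).** By compactness of `K` it suffices to bound the gradients on
a small disc around each point `z⋆ ∈ U`.  Fix `δ > 0` with `B̄(z⋆, 4δ) ⊆ U`; on this compact disc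
`u n → v` uniformly, so the `u n` are uniformly bounded there by some `R`.  If the gradients were
unbounded on `B(z⋆, δ)`, pick `n_j`, `z_j ∈ B(z⋆, δ)` with `‖d(u n_j)(z_j)‖ > 2/δ + j`; then
`n_j → ∞` (finitely many maps have bounded gradients near `z⋆`).  The rescaled maps
`f_j(w) = u n_j (z_j + δ w)` are `C¹` on `B(0, 2)` with `‖df_j(0)‖ > 2 + δ j`.  The Zalcman lemma
with domain control (`helper_gradBoundOfC0_zalcman` of the sibling file
`Summits/SmoothPoincare4/SmoothPoincare4/Theorems/` +
`SullivanDualWitnessChargeHelperGradBoundOfC0Aux.lean`, which also provides the affine chain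
rule and the uniform-limit lemmas `GradBound.*`) yields centres `‖ξ_j‖ < 1`, scales
`ρ_j ≤ 1 / M_j → 0` and maps `g_j(ζ) = f_j(ξ_j + ρ_j ζ) = u n_j (p_j + δ ρ_j ζ)`,
`p_j = z_j + δ ξ_j ∈ B̄(z⋆, 4δ)`, with `‖dg_j(0)‖ = 1`, `‖dg_j‖ ≤ 2` and values `u n_j(B̄(z⋆, 4δ))`
on the closed unit disc.  Along a subsequence `p_j → p⋆`; since `ρ_j → 0`, `u n_j → v` uniformly
near `z⋆` and `v` is uniformly continuous there, `g_j → v(p⋆)` (a constant!) uniformly on the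
unit disc.  The `g_j` are `C^∞` and flat-`J`-holomorphic on the open unit disc with `C⁰` bound
`R` and `C¹` bound `2`, so `hD` bounds all their derivatives on compact subsets and `hS` gives
`dg_j(0) → d(const)(0) = 0`, contradicting `‖dg_j(0)‖ = 1`.

References: L. Zalcman, Amer. Math. Monthly 82 (1975); R. Brody, Trans. AMS 235 (1978);
C. Hummel, *Gromov's compactness theorem for pseudo-holomorphic curves* (1997), III.3.1.
-/

noncomputable section

set_option linter.dupNamespace false

open scoped ContDiff Topology Nat
open Filter Set Metric

namespace Summit.SmoothPoincare4.SmoothPoincare4.Theorems.WitnessCharge.PencilIncompleteness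

/-- **Local gradient bound (the Zalcman–Brody blow-up argument).** Under the two hypotheses of
`helper_gradBoundOfC0_of` (derivative bounds of all orders from `C⁰` + `C¹` bounds, and the local
smooth-limit lemma), flat-`J`-holomorphic maps on an open `U` converging locally uniformly on `U`
have gradients bounded uniformly in `n` on a small disc around every point of `U`. -/
theorem helper_gradBoundOfC0_local
    (hD :
      ∀ (J : EuclideanSpace ℝ (Fin 4) → EuclideanSpace ℝ (Fin 4) →L[ℝ] EuclideanSpace ℝ (Fin 4)),
      ContDiff ℝ ∞ J → (∀ x v, J x (J x v) = -v) →
      ∀ (U : Set ℂ), IsOpen U → ∀ (u : ℕ → ℂ → EuclideanSpace ℝ (Fin 4)),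
      (∀ n, ContDiffOn ℝ ∞ (u n) U) →
      (∀ n, ∀ z ∈ U, ∀ ζ : ℂ, fderiv ℝ (u n) z (Complex.I * ζ) = J (u n z) (fderiv ℝ (u n) z ζ)) →
      (∀ K : Set ℂ, IsCompact K → K ⊆ U → ∃ R : ℝ, ∀ n, ∀ z ∈ K, ‖u n z‖ ≤ R) →
      (∀ K : Set ℂ, IsCompact K → K ⊆ U → ∃ L : ℝ, ∀ n, ∀ z ∈ K, ‖fderiv ℝ (u n) z‖ ≤ L) →
      ∀ (k : ℕ) (K : Set ℂ), IsCompact K → K ⊆ U →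
        ∃ C : ℝ, ∀ n, ∀ z ∈ K, ‖iteratedFDeriv ℝ k (u n) z‖ ≤ C)
    (hS : ∀ (U : Set ℂ), IsOpen U →
      ∀ (u : ℕ → ℂ → EuclideanSpace ℝ (Fin 4)) (v : ℂ → EuclideanSpace ℝ (Fin 4)),
      (∀ n, ContDiffOn ℝ ∞ (u n) U) →
      (∀ (k : ℕ) (K : Set ℂ), IsCompact K → K ⊆ U →
        ∃ C : ℝ, ∀ n, ∀ z ∈ K, ‖iteratedFDeriv ℝ k (u n) z‖ ≤ C) →
      TendstoLocallyUniformlyOn u v atTop U →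
      ContDiffOn ℝ ∞ v U ∧
        TendstoLocallyUniformlyOn (fun n => fderiv ℝ (u n)) (fderiv ℝ v) atTop U)
    {J : EuclideanSpace ℝ (Fin 4) → EuclideanSpace ℝ (Fin 4) →L[ℝ] EuclideanSpace ℝ (Fin 4)}
    (hJs : ContDiff ℝ ∞ J) (hJ2 : ∀ x v, J x (J x v) = -v)
    {U : Set ℂ} (hU : IsOpen U) {u : ℕ → ℂ → EuclideanSpace ℝ (Fin 4)}
    {v : ℂ → EuclideanSpace ℝ (Fin 4)}
    (hu : ∀ n, ContDiffOn ℝ ∞ (u n) U)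
    (huJ : ∀ n, ∀ z ∈ U, ∀ ζ : ℂ,
      fderiv ℝ (u n) z (Complex.I * ζ) = J (u n z) (fderiv ℝ (u n) z ζ))
    (hlim : TendstoLocallyUniformlyOn u v atTop U) {zs : ℂ} (hzs : zs ∈ U) :
    ∃ δ > 0, ∃ L : ℝ, ∀ n, ∀ z ∈ ball zs δ, ‖fderiv ℝ (u n) z‖ ≤ L := by
  /- room: `closedBall zs (4 δ) ⊆ U` -/
  obtain ⟨r, hr, hrU⟩ := Metric.nhds_basis_closedBall.mem_iff.mp (hU.mem_nhds hzs)
  obtain ⟨δ, hδ, hδr⟩ : ∃ δ : ℝ, 0 < δ ∧ 4 * δ = r := ⟨r / 4, by positivity, by ring⟩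
  set S : Set ℂ := closedBall zs (4 * δ) with hSdef
  have hSU : S ⊆ U := by rw [hSdef, hδr]; exact hrU
  have hSc : IsCompact S := isCompact_closedBall _ _
  have hcont : ∀ n, ContinuousOn (u n) S := fun n => (hu n).continuousOn.mono hSU
  have hdiffU : ∀ n, DifferentiableOn ℝ (u n) U := fun n => (hu n).differentiableOn (by simp)
  /- uniform convergence on `S`, continuity of the limit, uniform `C⁰` bound -/
  have hunif : TendstoUniformlyOn u v atTop S :=
    (tendstoLocallyUniformlyOn_iff_forall_isCompact hU).mp hlim S hSU hSc
  have hvS : ContinuousOn v S := hunif.continuousOn (Frequently.of_forall hcont)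
  obtain ⟨R, hR⟩ := GradBound.exists_bound_of_tendstoUniformlyOn hSc hcont hunif
  refine ⟨δ, hδ, ?_⟩
  by_contra hcon
  push Not at hcon
  /- blow-up sequence: `z j ∈ ball zs δ`, `‖d(u (n j))(z j)‖ > 2 / δ + j` -/
  choose n z hz hnz using fun j : ℕ => hcon (2 / δ + j)
  have hA : ∀ j (w : ℂ), ‖w‖ ≤ 3 → z j + δ • w ∈ S := fun j w hw => by
    rw [hSdef, mem_closedBall, dist_eq_norm, add_sub_right_comm]
    have h1 : ‖z j - zs‖ < δ := by rw [← dist_eq_norm]; exact hz j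
    have h2 : δ * ‖w‖ ≤ δ * 3 := mul_le_mul_of_nonneg_left hw hδ.le
    calc ‖z j - zs + δ • w‖ ≤ ‖z j - zs‖ + ‖δ • w‖ := norm_add_le _ _
      _ = ‖z j - zs‖ + δ * ‖w‖ := by rw [norm_smul, Real.norm_of_nonneg hδ.le]
      _ ≤ 4 * δ := by linarith
  have hzS : ∀ j, z j ∈ S := fun j => by simpa using hA j 0 (by norm_num)
  /- the indices `n j` tend to infinity: finitely many maps have bounded gradients on `S` -/
  have hn : Tendsto n atTop atTop := by
    refine tendsto_atTop_atTop.mpr fun N => ?_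
    obtain ⟨B, hB⟩ := GradBound.exists_bound_head (fun m w => ‖fderiv ℝ (u m) w‖)
      (fun m => hSc.exists_bound_of_continuousOn
        (((hu m).continuousOn_fderiv_of_isOpen hU (by simp)).mono hSU)) N
    refine ⟨⌈B⌉₊, fun j hj => ?_⟩
    by_contra hlt
    push Not at hlt
    have h1 : ‖fderiv ℝ (u (n j)) (z j)‖ ≤ B := hB (n j) hlt.le (z j) (hzS j)
    have h2 : B ≤ j := (Nat.le_ceil B).trans (by exact_mod_cast hj)
    have h3 := hnz j
    have h4 : (0 : ℝ) < 2 / δ := by positivity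
    linarith
  /- the rescaled maps `f j w = u (n j) (z j + δ • w)`, `C¹` on `ball 0 2`, `‖df_j(0)‖ > 2 + δ j` -/
  set f : ℕ → ℂ → EuclideanSpace ℝ (Fin 4) := fun j w => u (n j) (z j + δ • w) with hf
  have hfV : ∀ j, MapsTo (fun w : ℂ => z j + δ • w) (ball 0 2) U := fun j w hw =>
    hSU (hA j w (by linarith [mem_ball_zero_iff.mp hw]))
  have hf1 : ∀ j, ContDiffOn ℝ 1 (f j) (ball 0 2) := fun j =>
    (GradBound.contDiffOn_comp_affine (hu (n j)) (z j) δ (hfV j)).of_le (by exact_mod_cast le_top)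
  have hnf0 : ∀ j, ‖fderiv ℝ (f j) 0‖ = δ * ‖fderiv ℝ (u (n j)) (z j)‖ := fun j => by
    have hd : DifferentiableAt ℝ (u (n j)) (z j + δ • (0 : ℂ)) := by
      rw [smul_zero, add_zero]
      exact (hdiffU (n j)).differentiableAt (hU.mem_nhds (hSU (hzS j)))
    have := GradBound.norm_fderiv_comp_affine hd hδ.le
    rw [smul_zero, add_zero] at this
    simpa only [hf] using this
  have hbig : ∀ j, 2 + δ * j < ‖fderiv ℝ (f j) 0‖ := fun j => by
    rw [hnf0 j]
    have h1 := mul_lt_mul_of_pos_left (hnz j) hδ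
    have h2 : δ * (2 / δ + j) = 2 + δ * j := by
      field_simp
    linarith
  have hne : ∀ j, fderiv ℝ (f j) 0 ≠ 0 := fun j h => by
    have h1 := hbig j
    rw [h, norm_zero] at h1
    have h2 : (0 : ℝ) ≤ δ * j := by positivity
    linarith
  /- Zalcman rescaling with domain control, for every `j` -/
  choose ξ ρ M hρ hξ hM hρM hdom h1 h2 using
    fun j => helper_gradBoundOfC0_zalcman (f j) (hf1 j) (hne j)
  have hM2 : ∀ j, 2 + δ * j < M j := fun j => (hbig j).trans_le (hM j)
  have hM1 : ∀ j (ζ : ℂ), ‖ζ‖ ≤ 1 → ‖ζ‖ ≤ M j / 2 := fun j ζ hζ => by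
    have := hM2 j
    have : (0 : ℝ) ≤ δ * j := by positivity
    linarith
  have hin : ∀ j (ζ : ℂ), ‖ζ‖ ≤ 1 → ‖ξ j + ρ j • ζ‖ < 1 := fun j ζ hζ => by
    have := hdom j ζ (hM1 j ζ hζ)
    have := hξ j
    linarith
  have hρle : ∀ j, ρ j ≤ 1 / (2 + δ * j) := fun j => by
    rw [le_div_iff₀ (by positivity)]
    exact (mul_le_mul_of_nonneg_left (hM2 j).le (hρ j).le).trans (hρM j)
  /- the centres `p j = z j + δ • ξ j` and the rescaled maps `ζ ↦ u (n j) (p j + (δ ρ j) • ζ)` -/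
  set p : ℕ → ℂ := fun j => z j + δ • ξ j with hp
  have hfg : ∀ j, (fun ζ : ℂ => f j (ξ j + ρ j • ζ)) =
      fun ζ : ℂ => u (n j) (p j + (δ * ρ j) • ζ) := fun j => by
    funext ζ
    simp only [hf, hp, smul_add, smul_smul, add_assoc]
  have hmemS : ∀ j (ζ : ℂ), ‖ζ‖ ≤ 1 → p j + (δ * ρ j) • ζ ∈ S := fun j ζ hζ => by
    have e : p j + (δ * ρ j) • ζ = z j + δ • (ξ j + ρ j • ζ) := by
      simp only [hp, smul_add, smul_smul, add_assoc]
    rw [e]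
    exact hA j _ (by linarith [hin j ζ hζ])
  have hpS : ∀ j, p j ∈ S := fun j => by simpa using hmemS j 0 (by norm_num)
  /- subsequence with convergent centres; along it `ρ → 0` and `n → ∞` -/
  obtain ⟨ps, hps, σ, hσ, hpσ⟩ := hSc.tendsto_subseq hpS
  have hMt : Tendsto (fun k : ℕ => 2 + δ * (σ k : ℝ)) atTop atTop :=
    tendsto_atTop_add_const_left _ _
      ((tendsto_natCast_atTop_atTop.comp hσ.tendsto_atTop).const_mul_atTop hδ)
  have hρσ : Tendsto (fun k => ρ (σ k)) atTop (𝓝 0) :=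
    squeeze_zero (fun k => (hρ _).le) (fun k => hρle (σ k)) (tendsto_const_nhds.div_atTop hMt)
  have hρ0 : Tendsto (fun k => δ * ρ (σ k)) atTop (𝓝 0) := by
    simpa using hρσ.const_mul δ
  have hunifσ : TendstoUniformlyOn (fun k => u (n (σ k))) v atTop S :=
    GradBound.tendstoUniformlyOn_comp hunif (hn.comp hσ.tendsto_atTop)
  set G : ℕ → ℂ → EuclideanSpace ℝ (Fin 4) :=
    fun k ζ => u (n (σ k)) (p (σ k) + (δ * ρ (σ k)) • ζ) with hG
  have hmapV : ∀ k, MapsTo (fun η : ℂ => p (σ k) + (δ * ρ (σ k)) • η) (ball 0 1) U :=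
    fun k η hη => hSU (hmemS (σ k) η (mem_ball_zero_iff.mp hη).le)
  have hGsmooth : ∀ k, ContDiffOn ℝ ∞ (G k) (ball 0 1) := fun k =>
    GradBound.contDiffOn_comp_affine (hu (n (σ k))) (p (σ k)) (δ * ρ (σ k)) (hmapV k)
  have hGJ : ∀ k, ∀ η ∈ ball (0 : ℂ) 1, ∀ ζ : ℂ,
      fderiv ℝ (G k) η (Complex.I * ζ) = J (G k η) (fderiv ℝ (G k) η ζ) := fun k =>
    GradBound.jHol_comp_affine hU (hdiffU _) (huJ _) (p (σ k)) (δ * ρ (σ k)) (hmapV k)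
  have hG1 : ∀ k, ‖fderiv ℝ (G k) 0‖ = 1 := fun k => by
    have := h1 (σ k)
    rwa [hfg] at this
  have hG2 : ∀ k (ζ : ℂ), ‖ζ‖ ≤ 1 → ‖fderiv ℝ (G k) ζ‖ ≤ 2 := fun k ζ hζ => by
    have := h2 (σ k) ζ (hM1 _ ζ hζ)
    rwa [hfg] at this
  have hGR : ∀ k (ζ : ℂ), ‖ζ‖ ≤ 1 → ‖G k ζ‖ ≤ R := fun k ζ hζ =>
    hR (n (σ k)) _ (hmemS (σ k) ζ hζ)
  have hGlim : TendstoUniformlyOn G (fun _ => v ps) atTop (ball 0 1) :=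
    GradBound.tendstoUniformlyOn_const hSc hvS hunifσ (q := fun k => p (σ k)) hpσ hps
      (t := fun k => δ * ρ (σ k)) hρ0 (fun k ζ hζ => hmemS (σ k) ζ hζ.le)
  /- derivative bounds of all orders (`hD`) and the smooth-limit lemma (`hS`) on the unit disc -/
  have hDG := hD J hJs hJ2 (ball (0 : ℂ) 1) isOpen_ball G hGsmooth hGJ
    (fun K' _ hK'V => ⟨R, fun k ζ hζ => hGR k ζ (mem_ball_zero_iff.mp (hK'V hζ)).le⟩)
    (fun K' _ hK'V => ⟨2, fun k ζ hζ => hG2 k ζ (mem_ball_zero_iff.mp (hK'V hζ)).le⟩)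
  obtain ⟨-, hSd⟩ := hS (ball (0 : ℂ) 1) isOpen_ball G (fun _ => v ps) hGsmooth hDG
    hGlim.tendstoLocallyUniformlyOn
  have ht : Tendsto (fun k => ‖fderiv ℝ (G k) 0‖) atTop
      (𝓝 ‖fderiv ℝ (fun _ : ℂ => v ps) (0 : ℂ)‖) :=
    (hSd.tendsto_at (mem_ball_self one_pos)).norm
  rw [fderiv_const_apply, norm_zero] at ht
  simp only [hG1] at ht
  exact one_ne_zero (tendsto_nhds_unique tendsto_const_nhds ht)

/-- **Stub A5 (Zalcman upgrade: `C⁰_loc` convergence forces local gradient bounds).**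
Flat `J`-holomorphic maps on an open `U` converging locally uniformly on `U` have gradients
bounded uniformly in `n` on compact subsets of `U`: otherwise Zalcman rescaling
(`helper_gradBoundOfC0_zalcman`) at a blow-up point produces maps with gradient `1` at the origin
and `≤ 2` on the unit disc, which by the derivative bounds (first hypothesis) and the local smooth
limit lemma (second hypothesis) converge in `C¹_loc` — to a CONSTANT (the original maps converge
uniformly near the blow-up point and the rescaling radii shrink to `0`), contradiction
(`helper_gradBoundOfC0_local`); the compact `K` is then exhausted by `IsCompact.induction_on`. -/
theorem helper_gradBoundOfC0_of :
    (∀ (J : EuclideanSpace ℝ (Fin 4) → EuclideanSpace ℝ (Fin 4) →L[ℝ] EuclideanSpace ℝ (Fin 4)),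
      ContDiff ℝ ∞ J → (∀ x v, J x (J x v) = -v) →
    ∀ (U : Set ℂ), IsOpen U → ∀ (u : ℕ → ℂ → EuclideanSpace ℝ (Fin 4)),
      (∀ n, ContDiffOn ℝ ∞ (u n) U) →
      (∀ n, ∀ z ∈ U, ∀ ζ : ℂ, fderiv ℝ (u n) z (Complex.I * ζ) = J (u n z) (fderiv ℝ (u n) z ζ)) →
      (∀ K : Set ℂ, IsCompact K → K ⊆ U → ∃ R : ℝ, ∀ n, ∀ z ∈ K, ‖u n z‖ ≤ R) →
      (∀ K : Set ℂ, IsCompact K → K ⊆ U → ∃ L : ℝ, ∀ n, ∀ z ∈ K, ‖fderiv ℝ (u n) z‖ ≤ L) →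
      ∀ (k : ℕ) (K : Set ℂ), IsCompact K → K ⊆ U →
        ∃ C : ℝ, ∀ n, ∀ z ∈ K, ‖iteratedFDeriv ℝ k (u n) z‖ ≤ C) →
    (∀ (U : Set ℂ), IsOpen U →
      ∀ (u : ℕ → ℂ → EuclideanSpace ℝ (Fin 4)) (v : ℂ → EuclideanSpace ℝ (Fin 4)),
      (∀ n, ContDiffOn ℝ ∞ (u n) U) →
      (∀ (k : ℕ) (K : Set ℂ), IsCompact K → K ⊆ U →
        ∃ C : ℝ, ∀ n, ∀ z ∈ K, ‖iteratedFDeriv ℝ k (u n) z‖ ≤ C) →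
      TendstoLocallyUniformlyOn u v atTop U →
      ContDiffOn ℝ ∞ v U ∧
        TendstoLocallyUniformlyOn (fun n => fderiv ℝ (u n)) (fderiv ℝ v) atTop U) →
    ∀ (J : EuclideanSpace ℝ (Fin 4) → EuclideanSpace ℝ (Fin 4) →L[ℝ] EuclideanSpace ℝ (Fin 4)),
      ContDiff ℝ ∞ J → (∀ x v, J x (J x v) = -v) →
    ∀ (U : Set ℂ), IsOpen U →
      ∀ (u : ℕ → ℂ → EuclideanSpace ℝ (Fin 4)) (v : ℂ → EuclideanSpace ℝ (Fin 4)),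
      (∀ n, ContDiffOn ℝ ∞ (u n) U) →
      (∀ n, ∀ z ∈ U, ∀ ζ : ℂ, fderiv ℝ (u n) z (Complex.I * ζ) = J (u n z) (fderiv ℝ (u n) z ζ)) →
      TendstoLocallyUniformlyOn u v atTop U →
      ∀ K : Set ℂ, IsCompact K → K ⊆ U → ∃ L : ℝ, ∀ n, ∀ z ∈ K, ‖fderiv ℝ (u n) z‖ ≤ L := by
  intro hD hS J hJs hJ2 U hU u v hu huJ hlim K hK hKU
  refine hK.induction_on ⟨0, fun n z hz => ?_⟩ (fun s t hst ⟨L, hL⟩ => ?_)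
    (fun s t ⟨L₁, h₁⟩ ⟨L₂, h₂⟩ => ?_) (fun x hx => ?_)
  · exact absurd hz (notMem_empty z)
  · exact ⟨L, fun n z hz => hL n z (hst hz)⟩
  · exact ⟨max L₁ L₂, fun n z hz => hz.elim (fun h => (h₁ n z h).trans (le_max_left _ _))
      fun h => (h₂ n z h).trans (le_max_right _ _)⟩
  · obtain ⟨δ, hδ, L, hL⟩ := helper_gradBoundOfC0_local hD hS hJs hJ2 hU hu huJ hlim (hKU hx)
    exact ⟨ball x δ, mem_nhdsWithin_of_mem_nhds (ball_mem_nhds x hδ), L, hL⟩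

end Summit.SmoothPoincare4.SmoothPoincare4.Theorems.WitnessCharge.PencilIncompleteness
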